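import Summits.AnomalousDissipation.AnomalousDissipation.Theorems.UniformRelaxationWitness.Negative.SeisWindow
import Summits.AnomalousDissipation.AnomalousDissipation.Theorems.RelaxingFamily.Negative.LinearEnstrophyBudget
import Literature.Analysis.FluidPDE.PassiveScalarReleaseExistence
import Literature.Analysis.FluidPDE.LongTimeAverageSlidingWindow
import HarnessLib

/-!
# Crux `LimitingAbsorption.FloorUpgrade` (stmt-AnomalousDissipation-15010), line
# `material-derivative-dichotomy`: stub `stub_boundedEnstrophyNoRelaxation`

Seis 2022, Remark 1, in the family form the line needs: a family of global Leray–Hopf velocities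
`v_j` on `T²` (steady smooth mean-zero force `g`, viscosities `ν_j > 0`, `ν_j → 0`) whose mean
enstrophy is bounded ALONG A SUBSEQUENCE in the eventual-Cesàro sense
(`∃ᶠ j, ∀ᶠ T, ∫₀ᵀ ‖∇v_j‖²₂ ≤ Z T`) cannot relax a smooth mean-zero profile `h ≠ 0` `ν`-uniformly and
phase-uniformly with constants `(C, γ)` (the `(U_h)` clause of `RelaxingFamily`, diffusivity `ν_j`).

Proof (the argument of
`UniformRelaxationWitness.Negative.relaxingFamily_false_with_tamePhases`, the tame phase being
produced by pigeonhole): rate `D = min(γ/2, 1)` and Seis' horizon `T = seisHorizon(‖h‖₁, C₀, D)`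
from the profile data alone; the windowed strain slope `M = √(Z₊T)·√T` (uniform in `j`) and Seis'
windowed constants `(κ₀, K)` for it; a level `j` OF THE SUBSEQUENCE with `ν_j ≤ κ₀` and
`log(1/ν_j) > K/D + 1` (`Filter.Frequently.and_eventually`); at that level the eventual bound
`∫₀^{NT} ‖∇v_j‖² ≤ Z N T` for `N` large and pigeonhole over the `N` consecutive windows
`(kT, (k+1)T)` give a phase `s = kT` with `∫ₛ^{s+T} ‖∇v_j‖² ≤ Z₊ T`, whence by Cauchy–Schwarz
`∫₀ᵀ ‖∇v_j(s+τ)‖₂ dτ ≤ M ≤ M(1+T)`; the release of `h` into `v_j(s + ·)` on `[0,T)` exists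
(`IsGlobalLerayHopf.exists_release`), decays on `(0,T)` by `(U_h)`, the drift is bounded in energy
on the window (`exists_energy_bound_shift`), and `seis_rmk1_window` gives `D ≤ K / log(1/ν_j)` —
contradiction with the choice of `j`.

## References

* C. Seis, Comm. Math. Phys. 399 (2023) 2071–2081 = arXiv:2003.08794, Thm. 2, Rmk. 1. [`Seis2022`]
-/

set_option linter.dupNamespace false

noncomputable section

open MeasureTheory Set Filter Topology
open scoped ENNReal NNReal InnerProductSpace
open Literature.Analysis Literature.Analysis.FluidPDE Literature.Analysis.FluidPDE.Torus

namespace Summit.AnomalousDissipation.AnomalousDissipation.Theorems.FloorUpgradeMDD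

open Literature.Analysis.FunctionSpaces Literature.Analysis.FunctionSpaces.Torus
open Summit.AnomalousDissipation.AnomalousDissipation.Theorems.UniformRelaxationWitness.Negative
open Summit.AnomalousDissipation.AnomalousDissipation.Theorems.RelaxingFamily.Negative

/-! ## Pigeonhole over consecutive windows -/

/-- Lower integrals over consecutive windows add up to at most the lower integral over their span:
`∑_{k<n} ∫⁻_{(kT,(k+1)T)} φ ≤ ∫⁻_{(0,nT)} φ` for `T ≥ 0` (disjoint additivity and monotonicity of
the lower integral in the domain). [folklore] -/
theorem sum_setLIntegral_Ioo_consecutive_le (φ : ℝ → ℝ≥0∞) {T : ℝ} (hT : 0 ≤ T) (n : ℕ) :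
    ∑ k ∈ Finset.range n, ∫⁻ t in Ioo ((k : ℝ) * T) (((k : ℝ) + 1) * T), φ t ≤
      ∫⁻ t in Ioo 0 ((n : ℝ) * T), φ t := by
  induction n with
  | zero => simp
  | succ n ih =>
    rw [Finset.sum_range_succ]
    have hdisj : Disjoint (Ioo (0 : ℝ) ((n : ℝ) * T)) (Ioo ((n : ℝ) * T) (((n : ℝ) + 1) * T)) :=
      Set.disjoint_left.2 fun t ht ht' => lt_asymm ht.2 ht'.1
    have hnT : 0 ≤ (n : ℝ) * T := mul_nonneg (Nat.cast_nonneg n) hT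
    calc (∑ k ∈ Finset.range n, ∫⁻ t in Ioo ((k : ℝ) * T) (((k : ℝ) + 1) * T), φ t) +
          ∫⁻ t in Ioo ((n : ℝ) * T) (((n : ℝ) + 1) * T), φ t
        ≤ (∫⁻ t in Ioo 0 ((n : ℝ) * T), φ t) + ∫⁻ t in Ioo ((n : ℝ) * T) (((n : ℝ) + 1) * T), φ t :=
          add_le_add ih le_rfl
      _ = ∫⁻ t in Ioo 0 ((n : ℝ) * T) ∪ Ioo ((n : ℝ) * T) (((n : ℝ) + 1) * T), φ t :=
          (lintegral_union measurableSet_Ioo hdisj).symm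
      _ ≤ ∫⁻ t in Ioo 0 (((n + 1 : ℕ) : ℝ) * T), φ t := by
          refine lintegral_mono_set (union_subset (Ioo_subset_Ioo le_rfl ?_) (Ioo_subset_Ioo hnT ?_))
          · push_cast; nlinarith
          · push_cast; exact le_rfl

/-- **Pigeonhole phase selection.** If `∫⁻_{(0,NT)} φ ≤ Z · (N T)` (as `ENNReal.ofReal`) for some
`N ≥ 1` and `T > 0`, then one of the `N` consecutive windows `(kT, (k+1)T)`, `k < N`, carries at most
`Z₊ T`: `∫⁻_{(0,T)} φ(kT + τ) dτ ≤ Z₊ T` (min ≤ average, then translation invariance of Lebesgue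
measure). [folklore] -/
theorem exists_phase_window_le_of_cesaro {φ : ℝ → ℝ≥0∞} {T Z : ℝ} (hT : 0 < T) {N : ℕ} (hN : 0 < N)
    (htot : ∫⁻ t in Ioo (0 : ℝ) ((N : ℝ) * T), φ t ≤ ENNReal.ofReal (Z * ((N : ℝ) * T))) :
    ∃ k : ℕ, k < N ∧ ∫⁻ τ in Ioo 0 T, φ ((k : ℝ) * T + τ) ≤ ENNReal.ofReal (max Z 0 * T) := by
  obtain ⟨k, hk, hle⟩ : ∃ k ∈ Finset.range N,
      ∫⁻ t in Ioo ((k : ℝ) * T) (((k : ℝ) + 1) * T), φ t ≤ ENNReal.ofReal (max Z 0 * T) := by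
    refine ENNReal.exists_le_of_sum_le (Finset.nonempty_range_iff.2 hN.ne') ?_
    calc ∑ k ∈ Finset.range N, ∫⁻ t in Ioo ((k : ℝ) * T) (((k : ℝ) + 1) * T), φ t
        ≤ ∫⁻ t in Ioo (0 : ℝ) ((N : ℝ) * T), φ t := sum_setLIntegral_Ioo_consecutive_le φ hT.le N
      _ ≤ ENNReal.ofReal (Z * ((N : ℝ) * T)) := htot
      _ ≤ ENNReal.ofReal (max Z 0 * ((N : ℝ) * T)) :=
          ENNReal.ofReal_le_ofReal (mul_le_mul_of_nonneg_right (le_max_left _ _) (by positivity))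
      _ = ENNReal.ofReal ((N : ℝ) * (max Z 0 * T)) := by rw [mul_left_comm]
      _ = ∑ k ∈ Finset.range N, ENNReal.ofReal (max Z 0 * T) := by
          rw [Finset.sum_const, Finset.card_range, nsmul_eq_mul,
            ENNReal.ofReal_mul (Nat.cast_nonneg _), ENNReal.ofReal_natCast]
  refine ⟨k, Finset.mem_range.1 hk, ?_⟩
  rw [setLIntegral_Ioo_add_left φ 0 T ((k : ℝ) * T), add_zero,
    show (k : ℝ) * T + T = ((k : ℝ) + 1) * T by ring]
  exact hle

/-! ## The stub -/

/-- **`stub_boundedEnstrophyNoRelaxation`** (Seis 2022, Remark 1, in family form). A family of global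
Leray–Hopf velocities `v_j` on `T²` (steady smooth mean-zero force `g`, viscosities `ν_j > 0`,
`ν_j → 0`, locally bounded on slabs) whose mean enstrophy is bounded ALONG A SUBSEQUENCE in the
eventual-Cesàro sense, `∃ᶠ j, ∀ᶠ T, ∫₀ᵀ ‖∇v_j‖²₂ ≤ Z T`, cannot relax a smooth mean-zero `h ≠ 0`
`ν`-uniformly AND phase-uniformly with constants `(C, γ)` (the `(U_h)` clause of `RelaxingFamily`,
diffusivity `= ν_j`). Proof: Seis' windowed floor `seis_rmk1_window` on the dissipation horizon
`T = seisHorizon(‖h‖₁, √((C+1)‖h‖₂²), min(γ/2,1))` at a level of the subsequence with `ν_j` small, from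
a phase `s = kT` selected by pigeonhole from the Cesàro enstrophy bound (windowed strain
`≤ √(Z₊T)√T` by Cauchy–Schwarz, uniform in `j`), with the release of `h` into `v_j(s + ·)`
(`IsGlobalLerayHopf.exists_release`), its `(U_h)` decay on `(0,T)` and the automatic finite-window
energy bound (`exists_energy_bound_shift`). [cite: Seis2022, Remark 1 (arXiv:2003.08794 p. 4); Thm 2] -/
theorem stub_boundedEnstrophyNoRelaxation :
    ∀ (g : UnitAddTorus (Fin 2) → EuclideanSpace ℝ (Fin 2)) (h : UnitAddTorus (Fin 2) → ℝ) (ν : ℕ → ℝ)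
      (v₀ : ℕ → UnitAddTorus (Fin 2) → EuclideanSpace ℝ (Fin 2))
      (v : ℕ → ℝ → UnitAddTorus (Fin 2) → EuclideanSpace ℝ (Fin 2)) (C γ Z : ℝ),
      FunctionSpaces.Torus.IsSmooth g → FunctionSpaces.Torus.HasZeroMean g →
      FunctionSpaces.Torus.IsSmooth h → FunctionSpaces.Torus.HasZeroMean h → h ≠ 0 →
      (∀ j, 0 < ν j) → Tendsto ν atTop (𝓝 0) →
      (∀ j, IsGlobalLerayHopf (ν j) (fun _ => g) (v₀ j) (v j)) →
      (∀ (j : ℕ) (T : ℝ), 0 < T →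
        MemLp (FunctionSpaces.Torus.stLift (v j)) ⊤ (volume.restrict (Ioo (0 : ℝ) T ×ˢ univ))) →
      0 ≤ C → 0 < γ →
      (∀ (j : ℕ) (s : ℝ), 0 ≤ s → ∀ (T : ℝ) (ϑ : ℝ → UnitAddTorus (Fin 2) → ℝ),
        IsWeakScalarTransportOn T (ν j) (fun t => v j (s + t)) h ϑ →
          ∀ᵐ t ∂(volume.restrict (Ioo (0 : ℝ) T)),
            scalarL2Sq (ϑ t) ≤ C * Real.exp (-(γ * t)) * scalarL2Sq h) →
      (∃ᶠ j in atTop, ∀ᶠ T in atTop,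
        ∫⁻ t in Ioo (0 : ℝ) T, FunctionSpaces.Torus.eGradNormSq (v j t) ≤ ENNReal.ofReal (Z * T)) →
      False := by
  intro g h ν v₀ v C γ Z _ _ hh hhm hh0 hν hνlim hLH _ hC hγ hrelax hfreq
  -- profile constants
  have ha : 0 < ∫ x, |h x| := integral_abs_pos_of_ne_zero hh hh0
  have hS : 0 < scalarL2Sq h := scalarL2Sq_pos_of_ne_zero hh hh0
  set C₀ : ℝ := Real.sqrt ((C + 1) * scalarL2Sq h) with hC₀def
  have hC₀sq : C₀ ^ 2 = (C + 1) * scalarL2Sq h := Real.sq_sqrt (by positivity)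
  have hC₀ : 0 < C₀ := Real.sqrt_pos.2 (by positivity)
  -- the rate and the horizon (profile data only)
  set D : ℝ := min (γ / 2) 1 with hD
  have hD0 : 0 < D := lt_min (by positivity) one_pos
  have hD1 : D ≤ 1 := min_le_right _ _
  have hDγ : D ≤ γ / 2 := min_le_left _ _
  set T : ℝ := seisHorizon (∫ x, |h x|) C₀ D with hT
  have hT0 : 0 < T := seisHorizon_pos hD0
  -- the `j`-uniform windowed strain slope, and Seis' constants for that slope
  set M : ℝ := Real.sqrt (max Z 0 * T) * Real.sqrt T with hMdef
  have hM : 0 ≤ M := mul_nonneg (Real.sqrt_nonneg _) (Real.sqrt_nonneg _)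
  obtain ⟨κ₀, K, hκ₀, -, hK, hSeis⟩ :=
    seis_rmk1_window (d := Fin 2) (∫ x, |h x|) (∫ x, ‖Torus.gradient h x‖) C₀ M ha hC₀ hM
  -- the level `j` in the subsequence: `ν_j ≤ κ₀` and `log (1/ν_j) > K/D + 1`
  set L₀ : ℝ := K / D + 1 with hL₀
  have hL₀pos : 0 < L₀ := by
    have : 0 ≤ K / D := by positivity
    linarith
  have hev : ∀ᶠ j in atTop, ν j < min κ₀ (Real.exp (-L₀)) :=
    hνlim.eventually (gt_mem_nhds (lt_min hκ₀ (Real.exp_pos _)))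
  obtain ⟨j, hjZ, hj⟩ := (hfreq.and_eventually hev).exists
  have hνκ : ν j ≤ κ₀ := (hj.trans_le (min_le_left _ _)).le
  have hlog : L₀ < Real.log (ν j)⁻¹ := by
    rw [Real.log_inv]
    have h1 : Real.log (ν j) < Real.log (Real.exp (-L₀)) :=
      Real.log_lt_log (hν j) (hj.trans_le (min_le_right _ _))
    rw [Real.log_exp] at h1
    linarith
  -- a good window at level `j`: pigeonhole over `N` consecutive windows of length `T`
  obtain ⟨T₁, hT₁⟩ := Filter.eventually_atTop.1 hjZ
  set N : ℕ := ⌈T₁ / T⌉₊ + 1 with hN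
  have hN0 : 0 < N := Nat.succ_pos _
  have hNT : T₁ ≤ (N : ℝ) * T := by
    have h1 : T₁ / T ≤ ⌈T₁ / T⌉₊ := Nat.le_ceil _
    rw [div_le_iff₀ hT0] at h1
    rw [hN]
    push_cast
    nlinarith
  obtain ⟨k, -, hk⟩ :=
    exists_phase_window_le_of_cesaro (φ := fun t => eGradNormSq (v j t)) hT0 hN0 (hT₁ _ hNT)
  set s : ℝ := (k : ℝ) * T with hsdef
  have hs : 0 ≤ s := by positivity
  -- the windowed strain from phase `s`, by Cauchy–Schwarz (measurability from the Leray–Hopf class)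
  have hm : AEStronglyMeasurable (Function.uncurry fun τ => v j (s + τ))
      (((volume : Measure ℝ).restrict (Ioo 0 T)).prod volume) := by
    have h1 := aestronglyMeasurable_stLift_translate hs le_rfl ((hLH j) (T + s) (by linarith)).weak.1
    have e : (fun τ => v j (τ + s)) = fun τ => v j (s + τ) := by funext τ; rw [add_comm]
    rw [e] at h1
    have h2 :=
      Literature.Analysis.FunctionSpaces.Torus.aestronglyMeasurable_uncurry_of_stLift_restrict h1
    rwa [volume_restrict_prod_eq] at h2
  have hf : AEMeasurable (fun τ => eGradNormSq (v j (s + τ))) (volume.restrict (Ioo 0 T)) :=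
    aemeasurable_eGradNormSq_slice hm
  have hbud : ∫⁻ τ in Ioo 0 T, eGradNormSq (v j (s + τ)) ^ (1 / 2 : ℝ) ≤
      ENNReal.ofReal (M * (1 + T)) :=
    calc ∫⁻ τ in Ioo 0 T, eGradNormSq (v j (s + τ)) ^ (1 / 2 : ℝ)
        ≤ (∫⁻ τ in Ioo 0 T, eGradNormSq (v j (s + τ))) ^ (1 / 2 : ℝ) *
            ENNReal.ofReal T ^ (1 / 2 : ℝ) := setLIntegral_rpow_half_le hf
      _ ≤ ENNReal.ofReal (max Z 0 * T) ^ (1 / 2 : ℝ) * ENNReal.ofReal T ^ (1 / 2 : ℝ) := by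
          gcongr
      _ = ENNReal.ofReal M := by
          rw [ofReal_rpow_half_eq_ofReal_sqrt, ofReal_rpow_half_eq_ofReal_sqrt,
            ← ENNReal.ofReal_mul (Real.sqrt_nonneg _)]
      _ ≤ ENNReal.ofReal (M * (1 + T)) :=
          ENNReal.ofReal_le_ofReal (le_mul_of_one_le_right hM (by linarith))
  -- energy on the window, a release on `[0,T)`, its decay on `(0,T)`
  obtain ⟨Mv, hMv⟩ := exists_energy_bound_shift (hLH j) hs hT0
  obtain ⟨θ, hθ, -⟩ := (hLH j).exists_release (hν j) hT0 hs (hh.memLp 2)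
  have hdec : ∀ᵐ t ∂((volume : Measure ℝ).restrict (Ioo 0 T)),
      scalarL2Sq (θ t) ≤ (C₀ * Real.exp (-(D * t))) ^ 2 := by
    filter_upwards [hrelax j s hs T θ hθ, ae_restrict_mem measurableSet_Ioo] with t ht ht0
    have hexp : Real.exp (-(γ * t)) ≤ Real.exp (-(2 * D * t)) :=
      Real.exp_le_exp.2 (by nlinarith [ht0.1])
    have e1 : (C₀ * Real.exp (-(D * t))) ^ 2 = (C + 1) * scalarL2Sq h * Real.exp (-(2 * D * t)) := by
      rw [mul_pow, hC₀sq, sq (Real.exp _), ← Real.exp_add]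
      congr 1
      ring
    rw [e1]
    have hE : 0 ≤ Real.exp (-(2 * D * t)) := (Real.exp_pos _).le
    calc scalarL2Sq (θ t) ≤ C * Real.exp (-(γ * t)) * scalarL2Sq h := ht
      _ ≤ C * Real.exp (-(2 * D * t)) * scalarL2Sq h := by gcongr
      _ ≤ (C + 1) * scalarL2Sq h * Real.exp (-(2 * D * t)) := by nlinarith [hS.le]
  -- Seis on the window at rate `D`
  have hDle : D ≤ K / Real.log (ν j)⁻¹ :=
    hSeis (ν j) D (fun t => v j (s + t)) h θ (hν j) hνκ hD0 hD1 ⟨Mv, hMv⟩ hbud hh hhm le_rfl le_rfl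
      hθ hdec
  -- contradiction with the choice of `j`
  have hLpos : 0 < Real.log (ν j)⁻¹ := hL₀pos.trans hlog
  rw [le_div_iff₀ hLpos] at hDle
  have h1 : D * L₀ < D * Real.log (ν j)⁻¹ := mul_lt_mul_of_pos_left hlog hD0
  have h2 : D * L₀ = K + D := by rw [hL₀]; field_simp
  linarith

end Summit.AnomalousDissipation.AnomalousDissipation.Theorems.FloorUpgradeMDD

end
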